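import Summits.BirchSwinnertonDyer.BirchSwinnertonDyer.Theorems.SylvesterTwoHeegnerIndexCMDataPairTrace
import Summits.BirchSwinnertonDyer.Rank1Residual.X11b.KolyvaginPointClassFixed
import HarnessLib

/-!
# The COUPLED Cassels–Tate telescope, XXXII: `Gal(K[d·n₀]/K[d]) ≤ ⨆_{q ∣ n₀} G_q` for a square-free `n₀`
# prime to an ARBITRARY base conductor `d` (Gross's «`G_n ≃ ∏ G_ℓ`» above HSY's base `d = 9p`; RESIDUE c v3
# (T-L1), the class term's invariance input (R5) at a general level)

Crux `UpperOffV0HSYPlus` (stmt-BirchSwinnertonDyer-19804).  The recipe's invariance input (R5) for the class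
term at the level `9pn₀` asks that every element of `Gal(K[9pn₀]/K[9p])` move `D_{n₀} y_{n₀}` into
`2^M E(K[9pn₀])`; (T12) (`…CoupledTelescopeDerivList`) proves it for each generator `σ_q` of
`G_q = Gal(K[9pn₀]/K[9pn₀/q])` and passes from generators to the group they generate.  This file supplies the
missing group-theoretic step at HSY's NON-square-free levels: x11b3's `ringClassGalOver_div_le_iSup` needs the
whole level square-free, #R-e1 `ringClassGalOver_nine_mul_le_sup` is the two-prime case; here, by induction on the
prime factorisation of `n₀` with a GROWING base (`d ↦ qd`), from the tree's ring-class-group identity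
`RingClass.ker_restrict_le_ker_sup_ker` (Cox (7.27): `K[cd] ∩ K[ℓd] = K[d]` inside `K[ℓcd]`) through the Artin
transport `ringClassGalOver_le_sup`:
* ★ `ringClassGalOver_le_iSup_primeFactors` — for `d ≠ 0`, `n₀` square-free with `Nat.Coprime n₀ d`, `N = d·n₀`:
  `ringClassGalOver ι N d ≤ ⨆ q ∈ n₀.primeFactors, ringClassGalOver ι N (N / q)`.
Theorems only (no definition / named fact / instance / notation); nothing asserted on 19804; no stub closed;
X12.CMAtTwo NOT proved; BSD not claimed for any curve.  Sources: [GrossLMS1991] §3 (p. 238–239: `G_n ≃ ∏ G_ℓ`);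
[Cox2013] §7.D (7.27), §9.A.  `lean search 'ringClassGalOver_le_iSup'` → only the square-free x11b3 form before this file.
-/

set_option linter.dupNamespace false -- Summits modules are `Summit.<Summit>.<Problem>…` by design
set_option autoImplicit false

noncomputable section

open scoped Classical

namespace Summit.BirchSwinnertonDyer.BirchSwinnertonDyer.Theorems.SylvesterTwoCMFlip

open NumberField
open Literature.NumberTheory.EllipticCurves
  Literature.NumberTheory.QuadraticFields.Quadratic
  Literature.NumberTheory.QuadraticFields Literature.NumberTheory.QuadraticFields.RingClass
  Summit.BirchSwinnertonDyer.BirchSwinnertonDyer.Theorems.SylvesterTwoCMData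
  Summit.BirchSwinnertonDyer.Rank1Residual.X11b.RingClassTower
  Summit.BirchSwinnertonDyer.Rank1Residual.X11b

variable {K : Type} [Field K] [NumberField K]

/-- ★ **`Gal(K[N]/K[d]) ≤ ⨆_{q ∣ n₀} Gal(K[N]/K[N/q])`, `N = d·n₀`, `n₀` square-free and prime to `d ≠ 0`**
(Gross 1991 §3: `G_n ≃ ∏_{ℓ ∣ n} G_ℓ`, here above an arbitrary base conductor `d` — HSY: `d = 9p`).  Induction on
the prime factorisation `n₀ = q·a`: `Gal(K[N]/K[d]) ≤ Gal(K[N]/K[ad]) · Gal(K[N]/K[qd])` (Cox (7.27) via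
`RingClass.ker_restrict_le_ker_sup_ker` + `ringClassGalOver_le_sup`), `ad = N/q`, and the induction hypothesis at
the base `qd`. [cite: GrossLMS1991, §3 (p. 238–239)] [cite: Cox2013, §7.D (7.27)] -/
theorem ringClassGalOver_le_iSup_primeFactors (hK : IsImaginaryQuadratic K) (ι : K →+* ℂ) {n₀ : ℕ}
    (hsq : Squarefree n₀) :
    ∀ {d N : ℕ}, d ≠ 0 → Nat.Coprime n₀ d → d * n₀ = N →
      ringClassGalOver ι N d ≤ ⨆ q ∈ n₀.primeFactors, ringClassGalOver ι N (N / q) := by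
  obtain ⟨bs, hbs⟩ := exists_basis_zero_eq_one hK.1
  have hω := basis_one_mul_self_eq bs hbs
  induction n₀ using induction_on_primes with
  | zero => exact fun _ _ _ ↦ absurd hsq not_squarefree_zero
  | one =>
    intro d N _ _ hN
    rw [Nat.mul_one] at hN
    subst hN
    exact ringClassGalOver_self_le ι _ _
  | prime_mul q a hq ih =>
    intro d N hd hcop hN
    rw [Nat.squarefree_mul_iff] at hsq
    obtain ⟨hqa, -, hsqa⟩ := hsq
    have ha0 : a ≠ 0 := hsqa.ne_zero
    have hqd : Nat.Coprime q d := Nat.Coprime.coprime_mul_right hcop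
    have had : Nat.Coprime a d := Nat.Coprime.coprime_mul_left hcop
    have hN0 : N ≠ 0 := by rw [← hN]; exact mul_ne_zero hd (mul_ne_zero hq.ne_zero ha0)
    have hdN : d ∣ N := ⟨q * a, hN.symm⟩
    have hm₁ : a * d ∣ N := ⟨q, by rw [← hN]; ring⟩
    have hm₂ : q * d ∣ N := ⟨a, by rw [← hN]; ring⟩
    have hfn : Ideal.span {((N : ℕ) : 𝓞 K)} ≠ ⊤ :=
      span_natCast_ne_top_of_ne_one bs hbs (by
        intro h1
        have h2 : 2 ≤ q := hq.two_le
        have h3 : 1 ≤ d * a := Nat.one_le_iff_ne_zero.mpr (mul_ne_zero hd ha0)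
        have h4 : N = q * (d * a) := by rw [← hN]; ring
        nlinarith)
    have hker := ker_restrict_le_ker_sup_ker (K := K) bs hbs hω (ℓ := q) (c := a) (d := d)
      (m₁ := a * d) (m₂ := q * d) (n := N) rfl rfl (by rw [← hN]; ring) hqa hqd had hfn hdN hm₁ hm₂
    -- Artin transport: the element form `ker_d = ker_{ad} · ker_{qd}`
    have hle : ringClassGalOver ι N d ≤ ringClassGalOver ι N (a * d) ⊔ ringClassGalOver ι N (q * d) := by
      refine ringClassGalOver_le_sup hK ι hN0 hm₁ hm₂ hdN fun x hx ↦ ?_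
      set A : Subgroup (RingClassGroup K N) := (restrict (K := K) hm₁).ker with hA
      set B : Subgroup (RingClassGroup K N) := (restrict (K := K) hm₂).ker with hB
      have hx' : x ∈ (restrict (K := K) hdN).ker := (MonoidHom.mem_ker).mpr hx
      have h : x ∈ A ⊔ B := hker hx'
      have hset : x ∈ ((A ⊔ B : Subgroup (RingClassGroup K N)) : Set (RingClassGroup K N)) := h
      rw [Subgroup.mul_normal A B] at hset
      obtain ⟨y, hy, z, hz, hyz⟩ := Set.mem_mul.mp hset
      refine ⟨y, z, ?_, ?_, hyz.symm⟩
      · have hy' : y ∈ A := hy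
        rw [hA] at hy'
        exact (MonoidHom.mem_ker).mp hy'
      · have hz' : z ∈ B := hz
        rw [hB] at hz'
        exact (MonoidHom.mem_ker).mp hz'
    refine hle.trans (sup_le ?_ ?_)
    · -- `ad = N / q` and `q ∈ (q·a).primeFactors`
      have hdiv : N / q = a * d := by
        rw [← hN, show d * (q * a) = a * d * q by ring, Nat.mul_div_cancel _ hq.pos]
      have hqmem : q ∈ (q * a).primeFactors :=
        Nat.mem_primeFactors.mpr ⟨hq, dvd_mul_right q a, mul_ne_zero hq.ne_zero ha0⟩
      rw [← hdiv]
      exact le_iSup₂_of_le q hqmem le_rfl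
    · -- the induction hypothesis at the base `qd`
      have hcop' : Nat.Coprime a (q * d) := Nat.Coprime.mul_right hqa.symm had
      have h' := ih hsqa (d := q * d) (N := N) (mul_ne_zero hq.ne_zero hd) hcop' (by rw [← hN]; ring)
      refine h'.trans (iSup₂_mono' fun q' hq' ↦ ⟨q', ?_, le_rfl⟩)
      rw [Nat.primeFactors_mul hq.ne_zero ha0]
      exact Finset.mem_union_right _ hq'

end Summit.BirchSwinnertonDyer.BirchSwinnertonDyer.Theorems.SylvesterTwoCMFlip

end
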